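import Mathlib.Algebra.Category.Grp.Injective
import Mathlib.Analysis.SpecialFunctions.Pow.Continuity
import Mathlib.FieldTheory.IsAlgClosed.Basic
import Mathlib.Analysis.Complex.Polynomial.Basic
import Literature.NumberTheory.GaloisRepresentations.HeckeCharacterArchType
import HarnessLib

/-!
# Weil's extension theorem in congruence form — auxiliary algebra and analysis

Route `IrreducibilityBySelfDuality`, crux `HalfIntegralTwistCM` (stmt-Langlands-14036), line
`two-primary-chevalley-core`, stub `stub_weilExtension` (S2, the "Tate seed"): a unitary archimedean type
`(m, t)` whose unit product kills the global units `≡ 1 (mod a)` is the archimedean type of a Hecke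
character.  This file carries the two non-idelic ingredients of the proof:

* **Extension of characters into `ℂˣ`** (`exists_monoidHom_extension_of_subgroups`): for an abelian
  group `G`, subgroups `P, W ≤ G` and a character `φ : W → ℂˣ` killing `W ∩ P`, there is a character of
  `G` killing `P` and extending `φ`.  The divisible group `ℂˣ` is an injective `ℤ`-module (Baer's
  criterion, `baer_additive_units_complex`, copied from Mathlib's `Module.Baer.of_divisible` with the
  `m`-th roots supplied by `IsAlgClosed.exists_pow_nat_eq`), so the character `φ̄` of `W P / P ≅ W/(W∩P)`
  extends from the subgroup `W P/P` of `G/P` to all of `G/P`.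
* **The local factor `archUnitaryValue m t z = (z/|z|)^m |z|^{it}`** is multiplicative and continuous on
  `ℂ ∖ {0}` (`archUnitaryValue_mul'`, `continuousAt_archUnitaryValue`).

Everything here is [folklore]; the idelic part of the proof is in the sibling file
`IrreducibilityBySelfDualityHalfIntegralTwistCMWeilExtension.lean`.
-/

set_option linter.dupNamespace false -- project-wide option (lakefile weak.linter.dupNamespace); `Summit.Langlands.Langlands` is the mandated namespace

noncomputable section

open Literature.NumberTheory.GaloisRepresentations

namespace Summit.Langlands.Langlands.Theorems.HalfIntegralTwistCM

/-! ## `ℂˣ` is an injective abelian group -/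

/-- Every non-zero integer power map `x ↦ x ^ m` on `ℂˣ` is surjective (`ℂ` is algebraically closed).
[folklore] -/
theorem exists_zpow_eq_units_complex (a : ℂˣ) {m : ℤ} (hm : m ≠ 0) : ∃ r : ℂˣ, r ^ m = a := by
  have hn : 0 < m.natAbs := Int.natAbs_pos.mpr hm
  obtain ⟨s, hs⟩ := IsAlgClosed.exists_pow_nat_eq (a : ℂ) hn
  have hs0 : s ≠ 0 := fun h => a.ne_zero (by rw [← hs, h, zero_pow hn.ne'])
  set r₀ : ℂˣ := Units.mk0 s hs0 with hr₀
  have hr₀n : r₀ ^ m.natAbs = a := Units.ext (by rw [Units.val_pow_eq_pow_val, hr₀, Units.val_mk0, hs])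
  rcases Int.natAbs_eq m with h | h
  · refine ⟨r₀, ?_⟩
    rw [h, zpow_natCast, hr₀n]
  · refine ⟨r₀⁻¹, ?_⟩
    rw [h, zpow_neg, inv_zpow, inv_inv, zpow_natCast, hr₀n]

/-- **Baer's criterion holds for the `ℤ`-module `ℂˣ`** (written additively): every homomorphism from an
ideal `(m) ≤ ℤ` extends to `ℤ`, because `ℂˣ` is divisible.  Proof copied from Mathlib's
`Module.Baer.of_divisible`, with the `m`-th root from `exists_zpow_eq_units_complex`. [folklore] -/
theorem baer_additive_units_complex : Module.Baer ℤ (Additive ℂˣ) := fun I g ↦ by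
  rcases IsPrincipalIdealRing.principal I with ⟨m, rfl⟩
  obtain rfl | h0 := eq_or_ne m 0
  · refine ⟨0, fun n hn ↦ ?_⟩
    rw [Submodule.span_zero_singleton] at hn
    subst hn
    exact (map_zero g).symm
  let gₘ := g ⟨m, Submodule.subset_span (Set.mem_singleton _)⟩
  obtain ⟨r, hr⟩ := exists_zpow_eq_units_complex (Additive.toMul gₘ) h0
  have hr' : m • Additive.ofMul r = gₘ := by
    rw [← ofMul_zpow, hr, ofMul_toMul]
  refine ⟨LinearMap.toSpanSingleton ℤ (Additive ℂˣ) (Additive.ofMul r), fun n hn ↦ ?_⟩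
  rcases Submodule.mem_span_singleton.mp hn with ⟨n, rfl⟩
  rw [map_zsmul, LinearMap.toSpanSingleton_apply, hr', ← map_zsmul g, SetLike.mk_smul_mk]

/-- **Injectivity of `ℂˣ`**: a character of a subgroup of an abelian group extends to the whole group
(for an INJECTIVE hom `i : M → N` of abelian groups and `g : M → ℂˣ` there is `h : N → ℂˣ` with
`h ∘ i = g`). [folklore] -/
theorem exists_monoidHom_comp_eq_units_complex {M N : Type*} [CommGroup M] [CommGroup N]
    (i : M →* N) (hi : Function.Injective i) (g : M →* ℂˣ) :
    ∃ h : N →* ℂˣ, h.comp i = g := by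
  obtain ⟨h', hh'⟩ := Module.Baer.extension_property_addMonoidHom baer_additive_units_complex
    (MonoidHom.toAdditive i) hi (MonoidHom.toAdditive g)
  refine ⟨MonoidHom.toAdditive.symm h', ?_⟩
  apply MonoidHom.toAdditive.injective
  rw [← hh']
  rfl

/-- **Extension of a character killing the principal part.**  Let `G` be an abelian group, `P, W ≤ G`
subgroups and `φ : W → ℂˣ` a character which is trivial on every element of `W` lying in `P`.  Then
there is a character `ψ` of `G` trivial on `P` with `ψ|_W = φ`: pass to `G/P`, where `φ` induces a
character of the image `W P/P ≅ W/(W ∩ P)` of `W`, and extend by injectivity of `ℂˣ`.  (This is the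
algebraic half of Weil's / Tate's extension of an idele character from `Kˣ · W` to all ideles.)
[folklore] -/
theorem exists_monoidHom_extension_of_subgroups :
    ∀ {G : Type*} [CommGroup G] (P W : Subgroup G) (φ : W →* ℂˣ),
      (∀ w : W, (w : G) ∈ P → φ w = 1) →
        ∃ ψ : G →* ℂˣ, (∀ p ∈ P, ψ p = 1) ∧ ∀ w : W, ψ w = φ w := by
  intro G _ P W φ hφ
  set π : G →* G ⧸ P := QuotientGroup.mk' P with hπ
  set f : W →* G ⧸ P := π.comp W.subtype with hf
  have hker : f.ker ≤ φ.ker := by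
    intro w hw
    rw [MonoidHom.mem_ker] at hw ⊢
    refine hφ w ?_
    have : ((w : G) : G ⧸ P) = 1 := hw
    exact (QuotientGroup.eq_one_iff _).mp this
  set g₀ : W ⧸ f.ker →* ℂˣ := QuotientGroup.lift f.ker φ hker with hg₀
  set e : W ⧸ f.ker ≃* f.range := QuotientGroup.quotientKerEquivRange f with he
  set g : f.range →* ℂˣ := g₀.comp e.symm.toMonoidHom with hg
  obtain ⟨h, hh⟩ := exists_monoidHom_comp_eq_units_complex f.range.subtype
    f.range.subtype_injective g
  refine ⟨h.comp π, fun p hp => ?_, fun w => ?_⟩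
  · rw [MonoidHom.comp_apply, hπ, QuotientGroup.mk'_apply, (QuotientGroup.eq_one_iff p).mpr hp,
      map_one]
  · have hfw : f w ∈ f.range := ⟨w, rfl⟩
    have h1 : h.comp π w = h (f.range.subtype ⟨f w, hfw⟩) := rfl
    have h2 : e (QuotientGroup.mk w : W ⧸ f.ker) = ⟨f w, hfw⟩ := rfl
    rw [h1, ← MonoidHom.comp_apply, hh, hg, MonoidHom.comp_apply, MulEquiv.coe_toMonoidHom, ← h2,
      MulEquiv.symm_apply_apply, hg₀, QuotientGroup.lift_mk]

/-! ## The local factor `(z/|z|)^m |z|^{it}` -/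

/-- `archUnitaryValue m t` is multiplicative: `(zz'/|zz'|)^m |zz'|^{it} = ((z/|z|)^m|z|^{it}) ((z'/|z'|)^m|z'|^{it})`
(complex powers of non-negative reals multiply). [folklore] -/
theorem archUnitaryValue_mul' {z z' : ℂ} (m : ℤ) (t : ℝ) :
    archUnitaryValue m t (z * z') = archUnitaryValue m t z * archUnitaryValue m t z' := by
  unfold archUnitaryValue
  rw [norm_mul, Complex.ofReal_mul, Complex.mul_cpow_ofReal_nonneg (norm_nonneg _) (norm_nonneg _),
    mul_div_mul_comm, mul_zpow]
  ring

/-- `archUnitaryValue m t` is continuous away from `0` (`z/|z|` and `|z|^{it} = exp(it log|z|)` are).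
[folklore] -/
theorem continuousAt_archUnitaryValue (m : ℤ) (t : ℝ) {z : ℂ} (hz : z ≠ 0) :
    ContinuousAt (archUnitaryValue m t) z := by
  have hnorm : ContinuousAt (fun z : ℂ => ((‖z‖ : ℝ) : ℂ)) z :=
    (Complex.continuous_ofReal.comp continuous_norm).continuousAt
  have hz' : ((‖z‖ : ℝ) : ℂ) ≠ 0 := by exact_mod_cast norm_ne_zero_iff.mpr hz
  have h1 : ContinuousAt (fun z : ℂ => (z / ((‖z‖ : ℝ) : ℂ)) ^ m) z :=
    (continuousAt_id.div hnorm hz').zpow₀ m (Or.inl (div_ne_zero hz hz'))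
  have h2 : ContinuousAt (fun z : ℂ => ((‖z‖ : ℝ) : ℂ) ^ ((t : ℂ) * Complex.I)) z := by
    have hslit : ((‖z‖ : ℝ) : ℂ) ∈ Complex.slitPlane :=
      Complex.ofReal_mem_slitPlane.mpr (norm_pos_iff.mpr hz)
    exact ContinuousAt.comp (g := fun w : ℂ => w ^ ((t : ℂ) * Complex.I))
      (continuousAt_cpow_const hslit) hnorm
  exact h1.mul h2

end Summit.Langlands.Langlands.Theorems.HalfIntegralTwistCM

end
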